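import Summits.Langlands.Langlands.Theses.RuelleTorsionArtinWeight
import Summits.Langlands.Langlands.Theorems.IrreducibilityBySelfDualityIrreducibleOffSectorLanglandsOfReciprocity
import Summits.Langlands.Langlands.Theorems.IrreducibilityBySelfDualityReciprocityUpToIrreducibilityIsobaricRigidity
import Summits.Langlands.Langlands.Theorems.IrreducibilityBySelfDualityReciprocityUpToIrreducibilityDeRhamBlocks
import Summits.Langlands.Langlands.Theorems.IrreducibilityBySelfDualityReciprocityUpToIrreducibilityGeometricConstituents
import Literature.NumberTheory.Automorphic.IsAutomorphicAE
import Literature.NumberTheory.Automorphic.GLnAdelicStructureProofs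
import HarnessLib

/-!
# Birth skeleton (BC3) for crux stmt-Langlands-10839
`Summit.Langlands.Langlands.Theses.RuelleTorsionArtinWeight.ImQuadArtinJunction` — line `birth`

Route `route-Langlands-RuelleTorsionArtinWeight` (deciding theorem `closes : ArtinPointsBianchi →
ArtinWeightRealisation → ImQuadArtinJunction → Langlands`, rev 3).  The crux is the route's JUNCTION (filed support
rank 9, auto-cruxed 2026-08-16 as summit-strength):

  `ImQuadArtinJunction := StrongArtinImQuad → _root_.Langlands`,

where `H := StrongArtinImQuad` (the route's TARGET, item stmt-Langlands-10835) is direction (B) of the summit in its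
almost-everywhere form on the **imaginary-quadratic Artin `GL₂` sector**: for `K` totally complex with `[K:ℚ] = 2`,
every prime `p`, every `ι : ℚ̄_p ≃ ℂ` and every irreducible `σ : Γ_K → GL₂(ℚ̄_p)` with FINITE image there are a
compactness witness `hcpt` and a cuspidal `π` on `GL₂(𝔸_K)` with `SatakeFrobCompatibleAt ι π.1 σ w` for almost all
`w`.  Grounder g17-32 and refuters g41-16 / g43-0 / g43-1 agree: summit-strength junction, open-problem by design
(`Langlands → ImQuadArtinJunction := fun h _ => h`; `¬ImQuadArtinJunction ↔ StrongArtinImQuad ∧ ¬Langlands`); no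
Disproof.lean, no crux ideas, no `Theorems/ImQuadArtinJunction/Negative/` (`ledger crux ls stmt-Langlands-10839`,
2026-08-17: no workfiles).

## The skeleton: `Langlands` along the certified seam W / B_w / LGC / JS, with B_w cut along the im-quad Artin plane

The only typed decomposition of the summit the tree has certified (sibling junction
`CapacityClassicality.SectorToLanglands`, stmt-Langlands-10368, `Cruxes/SectorToLanglands/Lines/SectorToLanglandsOfLeaves.lean`,
rc 0, 0 sorry — the text form of the landed decoupling `ReciprocityUpToIrreducibility.reciprocityUpToIrreducibility_of_weak`,
p116715; re-used the same way by the sibling junction skeleton `Cruxes/SectorComplement/Lines/birth.lean`,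
stmt-Langlands-14623) is

  `W → B_w → LGC → JS (2.2) → JS (2.3) → Langlands`

(W = Buzzard–Gee Conj. 3.2.2, weak form: a pinned-geometric avatar, Satake–Frobenius compatible a.e.; B_w =
Fontaine–Mazur–Langlands, a.e. form WITH L-algebraicity of the automorphic partner; LGC = Taylor 2004 Conj. 7 for
irreducible pinned-geometric a.e.-compatible pairs, the only clause carrying `∃ Rec`; JS = Arthur–Clozel Ch. 3
(2.2)/(2.3) for Borel–Jacquet data, the Literature named facts `JacquetShalika1981_partialPairL_boundary_repData` /
`…_pole_repData`).  The seam is NOT a one-liner: direction (A) needs the avatar of W to be IRREDUCIBLE, which is the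
isobaric bootstrap (landed `stub_geometricConstituents` p99702 / `stub_deRhamBlocks` p98936 / `stub_isobaricRigidity`
p105601) run with B_w, then the landed structural theorem
`IrreducibleOffSector.langlands_of_reciprocityUpToIrreducibility_text_of_JS` (Chebotarev–Brauer–Nesbitt uniqueness).

THIS file makes the crux's hypothesis `H = StrongArtinImQuad` load-bearing by cutting B_w along the **imaginary-quadratic
Artin plane** — the sector `IsTotallyComplex K ∧ [K:ℚ] = 2 ∧ n = 2 ∧ Finite (range ρ)` (exactly `H`'s binders):

* `stub_weakExistence` — W (open beyond regular algebraic `π` over CM / totally real fields; verbatim the sibling text);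
* `stub_weakAutomorphyOffImQuadArtin` — B_w OFF the plane (open: Fontaine–Mazur–Langlands for all `n`, all `K`,
  minus the one slice `H` speaks about);
* `stub_lAlgebraicOfArtinCompatible` — the ARCHIMEDEAN UPGRADE that turns `H`'s output into what the summit's (B)
  consumes ON the plane: a cuspidal `π` on `GL₂(𝔸_K)` that is Satake–Frobenius compatible a.e. with a finite-image
  irreducible `ρ : Γ_K → GL₂(ℚ̄_ℓ)` is L-algebraic.  True in substance and theorem-sized (Gelbart 1997 Prop. 4.1 =
  Jacquet–Langlands 1970 §12 / Langlands 1980 pp. 23–24: a.e. matching with an Artin `σ` forces `π_v = π(σ_v)` at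
  EVERY place, so `π_∞ = π(1,1)` at the complex place, archimedean parameter trivial on `ℂ^×`, infinity type
  `{(0,0),(0,0)}` — integral, Buzzard–Gee Def. 3.1.1); `H` itself is applied inside the composition, and this stub is
  where the line pays for the clause `π.1.IsLAlgebraic` that `H` omits;
* `stub_pairCompatibility` — LGC (open in general; verbatim the sibling text);
* `stub_pairLBoundaryJS`, `stub_pairLPoleJS` — the two Jacquet–Shalika named facts BY NAME (theorems of the
  literature, Literature T0 debts hanging on their `L²` leaves).

`ImQuadArtinJunction_of` (kernel-checked, no `sorry`; hypotheses = the six stub statements by name via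
`_Goal.stub_x := type_of% @stub_x`): `intro hH`; rebuild B_w by a case split on the plane — ON it, `hH` supplies
`∃ hcpt' π` (any two compactness witnesses are proof-irrelevantly equal, so `π` serves at the given `hcpt`) and
`stub_lAlgebraicOfArtinCompatible` supplies `π.1.IsLAlgebraic`; OFF it, `stub_weakAutomorphyOffImQuadArtin` — then
the sibling bootstrap verbatim.  `lean check`: sorries = the six stubs, nothing else.

Honest size report: `stub_weakExistence`, `stub_weakAutomorphyOffImQuadArtin`, `stub_pairCompatibility` are
summit-class (open problems; every catalogued `Literature/Barriers/Langlands/*` region sits inside one of them — the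
skeleton LOCALISES the barriers off the im-quad Artin plane, it does not evade them); `stub_lAlgebraicOfArtinCompatible`
is size L and is the one stub a prover of THIS route should take; the JS stubs are known theorems.

Disproof used: none exists for this crux (no `Disproof.lean`, no landed Negative lemma; dead_lines empty — first line
on this crux).  The homologous held junctions EvenArtinJunction (stmt-Langlands-2908, `Lines/Sketch-dead.md`) and
PhantomRMJunction record that a 0-stub truth table is NOT a skeleton; this file has six registered stubs and a
non-trivial seam, the shape that registered for SectorComplement (stmt-Langlands-14623).

References: K. Buzzard, T. Gee, LMS LNS 414 (2014), Conj. 3.2.1–3.2.2 and Def. 3.1.1 [BuzzardGeeLMS2014];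
J.-M. Fontaine, B. Mazur (1995), Conj. 1 [FontaineMazurGeometric1995]; R. Taylor, Ann. Fac. Sci. Toulouse 13 (2004),
Conj. 7–8 [TaylorGaloisRepresentations2004]; J. Arthur, L. Clozel, Ann. Math. Stud. 120, Ch. 3 §2 (2.2)–(2.3)
[ArthurClozelAMS120]; H. Jacquet, J. Shalika, AJM 103 (1981) [JacquetShalikaAJM1981II]; S. Gelbart, in *Modular Forms
and Fermat's Last Theorem* (1997), Prop. 4.1 [Gelbart1997]; H. Jacquet, R. P. Langlands, LNM 114 (1970), §12
[JacquetLanglands1970]; R. P. Langlands, *Base change for GL(2)*, Ann. Math. Stud. 96 (1980), pp. 23–24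
[Langlands1980AMS96]; L. Clozel (1990) §3.3 [Clozel1990]; F. Calegari, ICM 2022 survey §12 [Calegari2023].
-/

noncomputable section

set_option linter.dupNamespace false -- project-wide option; `Summit.Langlands.Langlands` is the mandated namespace

open scoped NumberField Classical Polynomial Topology
open Filter IsDedekindDomain Polynomial
open Literature.NumberTheory.Automorphic Literature.NumberTheory.GaloisRepresentations
open Summit.Langlands
open Summit.Langlands.Langlands.Theorems.ReciprocityUpToIrreducibility
open Summit.Langlands.Langlands.Theses.RuelleTorsionArtinWeight (StrongArtinImQuad ImQuadArtinJunction)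

namespace Summit.Langlands.Langlands.Cruxes.ImQuadArtinJunction.Birth

/-! ## 0. The crux, by name -/

/-- The crux IS `StrongArtinImQuad → Langlands`, definitionally (route text rev 3). [folklore] -/
theorem imQuadArtinJunction_iff : ImQuadArtinJunction ↔ (StrongArtinImQuad → _root_.Langlands) :=
  Iff.rfl

/-! ## 1. The six stubs (the ONLY sorries of this file) -/

/-- **stub W — weak existence** (Buzzard–Gee Conj. 3.2.2, weak form; OPEN beyond regular algebraic `π` over CM /
totally real `K` — Harris–Lan–Taylor–Thorne 2016 Thm A + Scholze 2015 V.4.2 give the avatar there, de Rham by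
A'Campo 2024 / Caraiani–Newton in the crystalline range; nothing for irregular `π` (NonRegularWeightBarrier) or for `K`
neither CM nor totally real (ShimuraVarietyRealizationBarrier)): every L-algebraic cuspidal `π` of `GL_n(𝔸_K)` has,
for all `ℓ, ι`, SOME `ρ : Γ_K → GL_n(ℚ̄_ℓ)` unramified a.e., de Rham above `ℓ` for Fontaine's pinned datum, and
Satake–Frobenius compatible with `π` a.e.  Verbatim the text of the sibling child `CapacityClassicality.WeakExistence`.
Why it might fail: it is the existence half of (A) of the summit, minus irreducibility and local–global compatibility.
[cite: BuzzardGeeLMS2014, Conj. 3.2.2] [cite: FontaineMazurGeometric1995, §1] -/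
theorem stub_weakExistence : ∀ (K : Type) [Field K] [NumberField K] (n : ℕ) (hcpt : Literature.NumberTheory.Automorphic.isCompact_glFiniteIntegralLevel n K), 0 < n → ∀ π : Literature.NumberTheory.Automorphic.CuspidalAutomorphicRepData n K hcpt, π.1.IsLAlgebraic → ∀ (ℓ : ℕ) [Fact ℓ.Prime] (ι : PadicAlgCl ℓ ≃+* ℂ), ∃ ρ : Literature.NumberTheory.GaloisRepresentations.FramedGaloisRep K (PadicAlgCl ℓ) n, ((∀ᶠ v : IsDedekindDomain.HeightOneSpectrum (NumberField.RingOfIntegers K) in cofinite, ρ.IsUnramifiedAt v) ∧ ∀ (v : IsDedekindDomain.HeightOneSpectrum (NumberField.RingOfIntegers K)) (hv : ((ℓ : ℕ) : NumberField.RingOfIntegers K) ∈ v.asIdeal), (Literature.NumberTheory.PAdicHodge.fontainePstAdicCompletion v ℓ hv).IsDeRhamFramed (ρ.toLocal v)) ∧ ∀ᶠ v : IsDedekindDomain.HeightOneSpectrum (NumberField.RingOfIntegers K) in cofinite, SatakeFrobCompatibleAt ι π.1 ρ v := by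
  sorry

/-- **stub B_w⁻ — weak automorphy OFF the imaginary-quadratic Artin plane** (Fontaine–Mazur 1995 Conj. 1 + Langlands,
a.e. form with L-algebraic partner, for every `n ≥ 1` and every number field `K`, EXCEPT the sector
`IsTotallyComplex K ∧ [K:ℚ] = 2 ∧ n = 2 ∧ range ρ finite` — the binders of `StrongArtinImQuad`; OPEN — known for odd Artin
`GL₂/ℚ` (Khare–Wintenberger 2009), regular Hodge–Tate weights under the automorphy-lifting provisos (BLGGT 2014, ACC+
2023), `GL₁` (class field theory); open for irregular weights, `n ≥ 3` non-self-dual, general `K`): every irreducible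
`ρ : Γ_K → GL_n(ℚ̄_ℓ)` unramified a.e. and de Rham above `ℓ` (pinned datum), NOT in the sector, has an L-algebraic
cuspidal `π` Satake–Frobenius compatible a.e.
Why it might fail: it is (B) of the summit minus one slice (false only if Fontaine–Mazur–Langlands fails off the plane).
[cite: FontaineMazurGeometric1995, Conj. 1] [cite: BuzzardGeeLMS2014, Conj. 3.2.2] [cite: KhareWintenberger2009, Thm. 1.2]
[cite: BarnetlambEtAl2014, Thm. A] -/
theorem stub_weakAutomorphyOffImQuadArtin : ∀ (K : Type) [Field K] [NumberField K] (n : ℕ) (hcpt : Literature.NumberTheory.Automorphic.isCompact_glFiniteIntegralLevel n K), 0 < n → ∀ (ℓ : ℕ) [Fact ℓ.Prime] (ι : PadicAlgCl ℓ ≃+* ℂ) (ρ : Literature.NumberTheory.GaloisRepresentations.FramedGaloisRep K (PadicAlgCl ℓ) n), ρ.toGaloisRep.IsIrreducible → ((∀ᶠ v : IsDedekindDomain.HeightOneSpectrum (NumberField.RingOfIntegers K) in cofinite, ρ.IsUnramifiedAt v) ∧ ∀ (v : IsDedekindDomain.HeightOneSpectrum (NumberField.RingOfIntegers K)) (hv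 : ((ℓ : ℕ) : NumberField.RingOfIntegers K) ∈ v.asIdeal), (Literature.NumberTheory.PAdicHodge.fontainePstAdicCompletion v ℓ hv).IsDeRhamFramed (ρ.toLocal v)) → ¬ (NumberField.IsTotallyComplex K ∧ Module.finrank ℚ K = 2 ∧ n = 2 ∧ Finite ρ.toMonoidHom.range) → ∃ π : Literature.NumberTheory.Automorphic.CuspidalAutomorphicRepData n K hcpt, π.1.IsLAlgebraic ∧ ∀ᶠ v : IsDedekindDomain.HeightOneSpectrum (NumberField.RingOfIntegers K) in cofinite, SatakeFrobCompatibleAt ι π.1 ρ v := by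
  sorry

/-- **stub B_w⁺-upgrade — an a.e. strong-Artin partner is L-algebraic** (the archimedean clause `H` omits; TRUE in
substance, size L).  For every number field `K`, every finite-image irreducible `ρ : Γ_K → GL₂(ℚ̄_ℓ)` and every cuspidal
`π` on `GL₂(𝔸_K)` with `SatakeFrobCompatibleAt ι π.1 ρ v` for almost all `v`, `π` is L-algebraic.  Proof plan:
`σ := ι ∘ ρ^∨ : Γ_K → GL₂(ℂ)` is an Artin representation and `π_v ≅ π(σ_v)` at almost all `v` (the summit's dictionary:
roots `ι⁻¹(α_j⁻¹)` of the arithmetic Frobenius, cf. `IrreducibleOffSectorIotaTransport`); by Gelbart 1997 Prop. 4.1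
(Jacquet–Langlands 1970 §12, functional equations of `L(s, π ⊗ χ)` and of the Artin `L(s, σ ⊗ χ)` — Brauer — and the
rigidity of local factors; Langlands 1980 pp. 23–24) `π_v = π(σ_v)` at EVERY place, in particular at each archimedean
`v`, where `σ_v` is trivial on `ℂ^× ⊆ W_{K_v}`; hence the archimedean parameter of `π` is `{0,0}` at every embedding
(infinity type `{(0,0),(0,0)}`, existence of the datum: Clozel 1990 §3.3, the named fact
`AutomorphicRepData.exists_hasInfinityType`), which is integral: `InfinityType.IsLAlgebraic`, Buzzard–Gee Def. 3.1.1.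
Why it might fail: only through the tree's `HasInfinityType` interface (a cuspidal datum with no archimedean parameter
would falsify it vacuously-in-reverse; excluded by `exists_hasInfinityType`), or a normalisation slip (unitary vs.
`|det|^{1/2}`: `SatakeFrobCompatibleAt` is the UNITARY/L-normalisation, `m = 1`, so weight `(0,0)` not `(½,−½)`).
[cite: Gelbart1997, Prop. 4.1] [cite: JacquetLanglands1970, §12] [cite: Langlands1980AMS96, pp. 23–24]
[cite: BuzzardGeeLMS2014, Def. 3.1.1] [cite: Clozel1990, §3.3] -/
theorem stub_lAlgebraicOfArtinCompatible : ∀ (K : Type) [Field K] [NumberField K] (hcpt : Literature.NumberTheory.Automorphic.isCompact_glFiniteIntegralLevel 2 K) (ℓ : ℕ) [Fact ℓ.Prime] (ι : PadicAlgCl ℓ ≃+* ℂ) (ρ : Literature.NumberTheory.GaloisRepresentations.FramedGaloisRep K (PadicAlgCl ℓ) 2), Finite ρ.toMonoidHom.range → ρ.toGaloisRep.IsIrreducible → ∀ π : Literature.NumberTheory.Automorphic.CuspidalAutomorphicRepData 2 K hcpt, (∀ᶠ v : IsDedekindDomain.HeightOneSpectrum (NumberField.RingOfIntegers K) in cofinite,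 SatakeFrobCompatibleAt ι π.1 ρ v) → π.1.IsLAlgebraic := by
  sorry

/-- **stub LGC — local–global compatibility for compatible pairs** (Taylor 2004 Conj. 7 at EVERY finite place, through
the Grothendieck–Deligne recipe at `v ∤ ℓ` and Fontaine's pinned `D_pst` at `v ∣ ℓ`, for ONE reciprocity datum `Rec`
per field — the only clause carrying `∃ Rec`; OPEN in general: known for regular algebraic conjugate self-dual `π` over
CM fields (Harris–Taylor, Taylor–Yoshida, Caraiani) and `ℓ ≠ p` beyond (Varma), open for irregular `π` and at `v ∣ ℓ`
in general; includes the Harris–Taylor debt `LocalLanglandsDatum` of `Rec` itself): verbatim the text of the sibling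
child `CapacityClassicality.PairCompatibility`.
Why it might fail: a.e.-compatible irreducible pairs with a local mismatch at a ramified place would refute it (none known).
[cite: TaylorGaloisRepresentations2004, Conj. 7] [cite: HarrisTaylorAMS2001, Thm. A] -/
theorem stub_pairCompatibility : ∀ (K : Type) [Field K] [NumberField K], ∃ Rec : ReciprocityData K, ∀ (n : ℕ) (hcpt : Literature.NumberTheory.Automorphic.isCompact_glFiniteIntegralLevel n K), 0 < n → ∀ (π : Literature.NumberTheory.Automorphic.CuspidalAutomorphicRepData n K hcpt), π.1.IsLAlgebraic → ∀ (ℓ : ℕ) [Fact ℓ.Prime] (ι : PadicAlgCl ℓ ≃+* ℂ) (ρ : Literature.NumberTheory.GaloisRepresentations.FramedGaloisRep K (PadicAlgCl ℓ) n), ρ.toGaloisRep.IsIrreducible → ((∀ᶠ v : IsDedekindDomain.HeightOneSpectrum (NumberField.RingOfIntegers K) in cofinite, ρ.IsUnramifiedAt v) ∧ ∀ (v : IsDedekindDomain.HeightOneSpectrum (NumberField.RingOfIntegers K)) (hv : ((ℓ : ℕ) : NumberField.RingOfIntegers K) ∈ v.asIdeal), (Literature.NumberTheory.PAdicHodge.fontainePstAdicCompletion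 v ℓ hv).IsDeRhamFramed (ρ.toLocal v)) → (∀ᶠ v : IsDedekindDomain.HeightOneSpectrum (NumberField.RingOfIntegers K) in cofinite, SatakeFrobCompatibleAt ι π.1 ρ v) → ∀ v : IsDedekindDomain.HeightOneSpectrum (NumberField.RingOfIntegers K), LocalGlobalCompatibleAt Rec ι π.1 ρ v := by
  sorry

/-- **stub JS (2.2)** — Jacquet–Shalika / Arthur–Clozel Ch. 3 (2.2) for Borel–Jacquet data, the Literature named fact BY
NAME (a THEOREM of the literature, a T0 debt of the tree hanging on its four `L²` leaves,
`JacquetShalika1981_partialPairL_boundary_repData_of_L2_leaves`; = item stmt-Langlands-13622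
`IrreducibilityBySelfDuality.PairLBoundaryJS` definitionally).
[cite: ArthurClozelAMS120, Ch. 3 §2 (2.2)] [cite: JacquetShalikaAJM1981II, Prop. 3.6 and Thm. 4.4] -/
theorem stub_pairLBoundaryJS : Literature.NumberTheory.Automorphic.JacquetShalika1981_partialPairL_boundary_repData := by
  sorry

/-- **stub JS (2.3)** — Jacquet–Shalika / Arthur–Clozel Ch. 3 (2.3) for Borel–Jacquet data, the Literature named fact BY
NAME (a THEOREM of the literature; T0 debt hanging on the single `L²` leaf `JacquetShalika1981_partialPairL_pole_of_eq_conj`,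
`JacquetShalika1981_partialPairL_pole_repData_of_pole_of_eq_conj`; rank one is already the theorem `…_pole_repData_one`).
[cite: ArthurClozelAMS120, Ch. 3 §2 (2.3)] [cite: JacquetShalikaAJM1981II, Prop. 3.6] -/
theorem stub_pairLPoleJS : Literature.NumberTheory.Automorphic.JacquetShalika1981_partialPairL_pole_repData := by
  sorry

/-! ## 2. The stub statements as named propositions (hypotheses of the composition, admissible by stub name)

Each `_Goal.stub_x` is `type_of% @stub_x`: literally the stub's statement, no text duplicated, no `sorry` inherited. -/

namespace _Goal

/-- The statement of `stub_weakExistence` (literally its type). [folklore] -/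
def stub_weakExistence : Prop :=
  type_of% @Summit.Langlands.Langlands.Cruxes.ImQuadArtinJunction.Birth.stub_weakExistence

/-- The statement of `stub_weakAutomorphyOffImQuadArtin` (literally its type). [folklore] -/
def stub_weakAutomorphyOffImQuadArtin : Prop :=
  type_of% @Summit.Langlands.Langlands.Cruxes.ImQuadArtinJunction.Birth.stub_weakAutomorphyOffImQuadArtin

/-- The statement of `stub_lAlgebraicOfArtinCompatible` (literally its type). [folklore] -/
def stub_lAlgebraicOfArtinCompatible : Prop :=
  type_of% @Summit.Langlands.Langlands.Cruxes.ImQuadArtinJunction.Birth.stub_lAlgebraicOfArtinCompatible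

/-- The statement of `stub_pairCompatibility` (literally its type). [folklore] -/
def stub_pairCompatibility : Prop :=
  type_of% @Summit.Langlands.Langlands.Cruxes.ImQuadArtinJunction.Birth.stub_pairCompatibility

/-- The statement of `stub_pairLBoundaryJS` (literally its type). [folklore] -/
def stub_pairLBoundaryJS : Prop :=
  type_of% @Summit.Langlands.Langlands.Cruxes.ImQuadArtinJunction.Birth.stub_pairLBoundaryJS

/-- The statement of `stub_pairLPoleJS` (literally its type). [folklore] -/
def stub_pairLPoleJS : Prop :=
  type_of% @Summit.Langlands.Langlands.Cruxes.ImQuadArtinJunction.Birth.stub_pairLPoleJS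

end _Goal

/-! ## 3. The composition (kernel-checked, no `sorry`):
W → B_w⁻ → (L-algebraic upgrade) → LGC → JS (2.2) → JS (2.3) → ImQuadArtinJunction -/

/-- **`ImQuadArtinJunction` from its six stubs.**  Given `H = StrongArtinImQuad` (the crux's antecedent), B_w
(Fontaine–Mazur–Langlands, a.e. form with L-algebraic partner) is rebuilt from its two halves by a case split on the
imaginary-quadratic Artin plane: ON the plane `H` supplies the cuspidal partner (at its own compactness witness, equal
to the given one by proof irrelevance) and `stub_lAlgebraicOfArtinCompatible` its L-algebraicity; OFF the plane
`stub_weakAutomorphyOffImQuadArtin`.  Then, verbatim, the sibling's isobaric bootstrap (irreducibility of W's avatar: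
geometric constituents + de Rham heredity, B_w on the constituents, Jacquet–Shalika rigidity), the packaging of
reciprocity-up-to-irreducibility for the `Rec` of LGC, and the landed structural
`IrreducibleOffSector.langlands_of_reciprocityUpToIrreducibility_text_of_JS`.  Hypotheses = the six stub statements by
name; conclusion = the route decl by name.  [cite: BuzzardGeeLMS2014, Conj. 3.2.1 and Conj. 3.2.2]
[cite: ArthurClozelAMS120, Ch. 3 §2 (2.2)–(2.3)] [cite: CalegariGee2013, §1.1] [cite: DeligneSerreASENS1974, Lemme 3.2]
[cite: Gelbart1997, Prop. 4.1] -/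
theorem ImQuadArtinJunction_of (hW : _Goal.stub_weakExistence) (hOff : _Goal.stub_weakAutomorphyOffImQuadArtin)
    (hUp : _Goal.stub_lAlgebraicOfArtinCompatible) (hL : _Goal.stub_pairCompatibility)
    (hJSb : _Goal.stub_pairLBoundaryJS) (hJSp : _Goal.stub_pairLPoleJS) : ImQuadArtinJunction := by
  rw [imQuadArtinJunction_iff]
  intro hH
  dsimp only [_Goal.stub_weakExistence, _Goal.stub_weakAutomorphyOffImQuadArtin, _Goal.stub_lAlgebraicOfArtinCompatible,
    _Goal.stub_pairCompatibility, _Goal.stub_pairLBoundaryJS, _Goal.stub_pairLPoleJS] at hW hOff hUp hL hJSb hJSp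
  -- B_w (Fontaine–Mazur–Langlands, a.e. form) from its two halves: the im-quad Artin plane is discharged by H + hUp
  have hB : ∀ (K : Type) [Field K] [NumberField K] (n : ℕ) (hcpt : Literature.NumberTheory.Automorphic.isCompact_glFiniteIntegralLevel n K), 0 < n → ∀ (ℓ : ℕ) [Fact ℓ.Prime] (ι : PadicAlgCl ℓ ≃+* ℂ) (ρ : Literature.NumberTheory.GaloisRepresentations.FramedGaloisRep K (PadicAlgCl ℓ) n), ρ.toGaloisRep.IsIrreducible → ((∀ᶠ v : IsDedekindDomain.HeightOneSpectrum (NumberField.RingOfIntegers K) in cofinite, ρ.IsUnramifiedAt v) ∧ ∀ (v : IsDedekindDomain.HeightOneSpectrum (NumberField.RingOfIntegers K)) (hv : ((ℓ : ℕ) : NumberField.RingOfIntegers K) ∈ v.asIdeal), (Literature.NumberTheory.PAdicHodge.fontainePstAdicCompletion v ℓ hv).IsDeRhamFramed (ρ.toLocal v)) → ∃ π : Literature.NumberTheory.Automorphic.CuspidalAutomorphicRepData n K hcpt, π.1.IsLAlgebraic ∧ ∀ᶠ v : IsDedekindDomain.HeightOneSpectrum (NumberField.RingOfIntegers K) in cofinite,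 SatakeFrobCompatibleAt ι π.1 ρ v := by
    intro K _ _ n hcpt hn ℓ _ ι ρ hirr hgeo
    by_cases hs : (NumberField.IsTotallyComplex K ∧ Module.finrank ℚ K = 2 ∧ n = 2 ∧ Finite ρ.toMonoidHom.range)
    · obtain ⟨hK, hK2, rfl, hfin⟩ := hs
      -- `hcpt' = hcpt` by proof irrelevance (`isCompact_glFiniteIntegralLevel 2 K : Prop`), so `π` serves at `hcpt`
      obtain ⟨hcpt', π, hπ⟩ := hH K hK hK2 ℓ ι ρ hfin hirr
      exact ⟨π, hUp K hcpt' ℓ ι ρ hfin hirr π hπ, hπ⟩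
    · exact hOff K n hcpt hn ℓ ι ρ hirr hgeo hs
  -- the isobaric bootstrap, run with B_w: a pinned-geometric avatar of a cuspidal `π` is irreducible
  have irr : ∀ (K : Type) [Field K] [NumberField K] (n : ℕ) (hcpt : isCompact_glFiniteIntegralLevel n K)
      (_ : 0 < n) (π : CuspidalAutomorphicRepData n K hcpt) (ℓ : ℕ) [Fact ℓ.Prime]
      (ι : PadicAlgCl ℓ ≃+* ℂ) (ρ : FramedGaloisRep K (PadicAlgCl ℓ) n),
      ((∀ᶠ v : HeightOneSpectrum (𝓞 K) in cofinite, ρ.IsUnramifiedAt v) ∧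
        ∀ (v : HeightOneSpectrum (𝓞 K)) (hv : ((ℓ : ℕ) : 𝓞 K) ∈ v.asIdeal),
          (Literature.NumberTheory.PAdicHodge.fontainePstAdicCompletion v ℓ hv).IsDeRhamFramed
            (ρ.toLocal v)) →
      (∀ᶠ v : HeightOneSpectrum (𝓞 K) in cofinite, SatakeFrobCompatibleAt ι π.1 ρ v) →
        ρ.toGaloisRep.IsIrreducible := by
    intro K _ _ n hcpt hn π ℓ _ ι ρ hgeo hρ
    obtain ⟨k, m, r, hr, hchar, -, hone⟩ :=
      stub_geometricConstituents stub_deRhamBlocks K ℓ n ρ hn hgeo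
    by_cases hk1 : k = 1
    · exact hone hk1
    have hk0 : k ≠ 0 := by
      rintro rfl
      have h1 := hchar 1
      simp only [Finset.univ_eq_empty, Finset.prod_empty] at h1
      have hdeg : (FramedRep.charpoly ρ 1).natDegree = n := by
        simp [FramedRep.charpoly, Matrix.charpoly_natDegree_eq_dim]
      rw [h1, natDegree_one] at hdeg
      omega
    have hk2 : 2 ≤ k := by omega
    have hσ : ∀ i, ∃ σ : CuspidalAutomorphicRepData (m i) K
        (isCompact_glFiniteIntegralLevel_holds (m i) K),
        ∀ᶠ v : HeightOneSpectrum (𝓞 K) in cofinite, SatakeFrobCompatibleAt ι σ.1 (r i) v := by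
      intro i
      obtain ⟨σ, -, hcorr⟩ := hB K (m i) (isCompact_glFiniteIntegralLevel_holds (m i) K) (hr i).1 ℓ ι
        (r i) (hr i).2.1 (hr i).2.2
      exact ⟨σ, hcorr⟩
    choose σ hσc using hσ
    refine (stub_isobaricRigidity hJSb hJSp K n hcpt π k m
      (fun i => isCompact_glFiniteIntegralLevel_holds (m i) K) σ hn hk2 (fun i => (hr i).1) ?_).elim
    have hall : ∀ᶠ v : HeightOneSpectrum (𝓞 K) in cofinite,
        ∀ i, SatakeFrobCompatibleAt ι (σ i).1 (r i) v :=
      Filter.eventually_all.mpr hσc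
    filter_upwards [hρ, hall] with v hv hvi
    intro α hα
    obtain ⟨α₀, hα₀, -, hcp⟩ := hv
    obtain rfl : α = α₀ := AutomorphicRepData.hasSatakeParamAt_unique_holds π.1 hα hα₀
    choose β hβ _hurβ hcpβ using hvi
    refine ⟨β, hβ, ?_⟩
    have hprod : ρ.HasFrobCharpolyAt v (∏ i, arithFrobPolyOfSatake ι v.residueCard 1 (β i)) := by
      intro 𝔓 h𝔓 τ hτ
      rw [hchar τ]
      exact Finset.prod_congr rfl fun i _ => hcpβ i 𝔓 h𝔓 τ hτ
    rw [← Summit.Langlands.Langlands.Theorems.IrreducibleOffSector.arithFrobPolyOfSatake_sum] at hprod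
    have heq : arithFrobPolyOfSatake ι v.residueCard 1 α =
        arithFrobPolyOfSatake ι v.residueCard 1 (∑ i, β i) :=
      GaloisRep.HasFrobCharpolyAt.unique_holds
        ((FramedGaloisRep.hasFrobCharpolyAt_toGaloisRep_iff v _ ρ).mpr hcp)
        ((FramedGaloisRep.hasFrobCharpolyAt_toGaloisRep_iff v _ ρ).mpr hprod)
    exact arithFrobPolyOfSatake_one_injective ι _ heq
  -- reciprocity up to irreducibility (the text of crux stmt-Langlands-14328) for the `Rec` of LGC
  have hE : ∀ (F : Type) [Field F] [NumberField F], ∃ Rec : ReciprocityData F, ∀ n : ℕ, 0 < n →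
      ∀ hcpt : isCompact_glFiniteIntegralLevel n F,
        (∀ π : CuspidalAutomorphicRepData n F hcpt, π.1.IsLAlgebraic →
          ∀ (ℓ : ℕ) [Fact ℓ.Prime] (ι : PadicAlgCl ℓ ≃+* ℂ),
            ∃ ρ : FramedGaloisRep F (PadicAlgCl ℓ) n, IsGeometricFramed Rec ρ ∧ Corresponds Rec ι π.1 ρ) ∧
        GaloisToAutomorphic n Rec hcpt := by
    intro F _ _
    obtain ⟨Rec, hRec⟩ := hL F
    refine ⟨Rec, fun n hn hcpt => ⟨fun π hLalg ℓ _ ι => ?_, fun ℓ _ ι ρ hirr hgeo => ?_⟩⟩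
    · obtain ⟨ρ, hgeo, hρ⟩ := hW F n hcpt hn π hLalg ℓ ι
      have hirr : ρ.toGaloisRep.IsIrreducible := irr F n hcpt hn π ℓ ι ρ hgeo hρ
      exact ⟨ρ, hgeo, hρ, hRec n hcpt hn π hLalg ℓ ι ρ hirr hgeo hρ⟩
    · obtain ⟨π, hLalg, hρ⟩ := hB F n hcpt hn ℓ ι ρ hirr hgeo
      exact ⟨π, hLalg, hρ, hRec n hcpt hn π hLalg ℓ ι ρ hirr hgeo hρ⟩
  -- the summit: irreducibility of every avatar and Chebotarev–Brauer–Nesbitt uniqueness (landed, structural)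
  exact Summit.Langlands.Langlands.Theorems.IrreducibleOffSector.langlands_of_reciprocityUpToIrreducibility_text_of_JS
    hJSb hJSp hE

/-- By-name sanity check (an `example`, not a declaration): the six stubs feed the composition as they stand. -/
example : ImQuadArtinJunction :=
  ImQuadArtinJunction_of stub_weakExistence stub_weakAutomorphyOffImQuadArtin stub_lAlgebraicOfArtinCompatible
    stub_pairCompatibility stub_pairLBoundaryJS stub_pairLPoleJS

end Summit.Langlands.Langlands.Cruxes.ImQuadArtinJunction.Birth

end
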